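import Mathlib
import Literature.MeasureTheory.Group.HaarTubePushforward
import HarnessLib

/-!
# Haar measure of a compact linear group as a push-forward of Lebesgue measure on a tube

Setting of `HaarTubePushforward.lean`: `ρ : K →* 𝔸` continuous, injective, multiplicative, from a
compact group `K` into a finite-dimensional real Banach algebra `𝔸` with an additive Haar
(Lebesgue) measure `μ`. Everything here is PROVED; no definitions, no named facts.

* `abs_det_mulLeft_eq_one` — left multiplication by `ρ(k)` has `|det| = 1` on `𝔸`
  (`k ↦ |det L_{ρ k}|` is a continuous multiplicative map from a compact group to `(0, ∞)`,
  hence trivial), so it preserves `μ`;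
* `exists_haar_lintegral_eq_tube` — with the invariant tube `Ω ⊇ interior ∋ 1` and the lift
  `qK : Ω → K` of the group-part projection: the push-forward `qK_* (μ|_Ω)` is a finite, non-zero,
  left-invariant Borel measure on `K`, hence (uniqueness of Haar measure on compact groups,
  Mathlib `isMulInvariant_eq_smul_of_compactSpace`) `c • haarMeasure ⊤` with `0 < c < ∞`:
  `c ∫_K F dHaar = ∫_Ω F(qK M) dμ(M)` for every measurable `F ≥ 0`.

This is the chart-free form of "Haar measure is a smooth positive density in local coordinates"
that turns Haar integrals `∫_K e^{-β S(k)} dk` over compact linear groups into Euclidean Laplace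
integrals `∫_Ω e^{-β S(q M)} dM` with real-analytic phase `S ∘ q` over a compact semianalytic
set — the input format of the asymptotic theory of Laplace integrals (Arnold–Gusein-Zade–Varchenko
II §7.3; Lin arXiv:1003.5338 Thm. 2.9), used for the Wilson action in
`MathematicalPhysics/QuantumFieldTheory/WilsonPartitionRegularVariationProofs.lean`.

## References

* B. C. Hall, *Lie Groups, Lie Algebras, and Representations*, 2nd ed. (2015), Cor. 3.45. [Hall2015]
* Mathlib, `MeasureTheory.Measure.isMulInvariant_eq_smul_of_compactSpace` (uniqueness of Haar
  measure on compact groups). [folklore]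
-/

noncomputable section

open NormedSpace Filter Topology Set Metric Function MeasureTheory MeasureTheory.Measure
open scoped ENNReal NNReal

namespace Literature.MeasureTheory.Group

variable {𝔸 : Type*} [NormedRing 𝔸] [NormedAlgebra ℚ 𝔸] [NormedAlgebra ℝ 𝔸] [CompleteSpace 𝔸]
  [FiniteDimensional ℝ 𝔸]
variable {K : Type*} [Group K] [TopologicalSpace K] [IsTopologicalGroup K] [CompactSpace K]

omit [NormedAlgebra ℚ 𝔸] [CompleteSpace 𝔸] [FiniteDimensional ℝ 𝔸] [IsTopologicalGroup K] in
/-- **Left multiplication by an element of a compact linear group is unimodular on `𝔸`**: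
`|det (M ↦ ρ(k) M)| = 1` (the continuous multiplicative map `k ↦ |det L_{ρ k}|` on a compact group
is bounded, hence `≤ 1`, hence `= 1` by `k ↦ k⁻¹`). [folklore] -/
theorem abs_det_mulLeft_eq_one (ρ : K →* 𝔸) (hρc : Continuous ρ) (k : K) :
    |(ContinuousLinearMap.mul ℝ 𝔸 (ρ k)).det| = 1 := by
  set φ : K → ℝ := fun k => |(ContinuousLinearMap.mul ℝ 𝔸 (ρ k)).det| with hφ
  have hcomp : ∀ k₁ k₂ : K, ContinuousLinearMap.mul ℝ 𝔸 (ρ (k₁ * k₂)) =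
      (ContinuousLinearMap.mul ℝ 𝔸 (ρ k₁)).comp (ContinuousLinearMap.mul ℝ 𝔸 (ρ k₂)) := by
    intro k₁ k₂; ext M; simp [mul_assoc]
  have hmulφ : ∀ k₁ k₂ : K, φ (k₁ * k₂) = φ k₁ * φ k₂ := by
    intro k₁ k₂
    simp only [hφ, ContinuousLinearMap.det, hcomp]
    rw [show (((ContinuousLinearMap.mul ℝ 𝔸 (ρ k₁)).comp (ContinuousLinearMap.mul ℝ 𝔸 (ρ k₂)) :
        𝔸 →L[ℝ] 𝔸) : 𝔸 →ₗ[ℝ] 𝔸) = ((ContinuousLinearMap.mul ℝ 𝔸 (ρ k₁) : 𝔸 →L[ℝ] 𝔸) :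
        𝔸 →ₗ[ℝ] 𝔸).comp ((ContinuousLinearMap.mul ℝ 𝔸 (ρ k₂) : 𝔸 →L[ℝ] 𝔸) : 𝔸 →ₗ[ℝ] 𝔸)
        from rfl, LinearMap.det_comp, abs_mul]
  have hone : ContinuousLinearMap.mul ℝ 𝔸 (ρ 1) = ContinuousLinearMap.id ℝ 𝔸 := by
    ext M; simp
  have hφ1 : φ 1 = 1 := by
    simp only [hφ, ContinuousLinearMap.det, hone, ContinuousLinearMap.coe_id, LinearMap.det_id,
      abs_one]
  have hφinv : ∀ k : K, φ k * φ k⁻¹ = 1 := fun k => by rw [← hmulφ, mul_inv_cancel, hφ1]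
  have hφpos : ∀ k : K, 0 < φ k := fun k =>
    lt_of_le_of_ne (abs_nonneg _) fun h => by simpa [← h] using hφinv k
  have hφc : Continuous φ :=
    continuous_abs.comp (ContinuousLinearMap.continuous_det.comp
      ((ContinuousLinearMap.mul ℝ 𝔸).continuous.comp hρc))
  -- bounded on the compact group, hence `≤ 1`
  obtain ⟨k₀, -, hk₀⟩ := isCompact_univ.exists_isMaxOn univ_nonempty hφc.continuousOn
  have hle : ∀ k : K, φ k ≤ 1 := by
    intro k
    by_contra hk
    push Not at hk
    have hpow : ∀ n : ℕ, φ (k ^ n) = φ k ^ n := fun n => by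
      induction n with
      | zero => simp [hφ1]
      | succ n ih => rw [pow_succ, hmulφ, ih, pow_succ]
    obtain ⟨n, hn⟩ := ((tendsto_pow_atTop_atTop_of_one_lt hk).eventually
      (eventually_gt_atTop (φ k₀))).exists
    have h' : φ (k ^ n) ≤ φ k₀ := hk₀ (mem_univ (k ^ n))
    rw [hpow] at h'
    exact absurd h' (not_le.2 hn)
  have hge : 1 ≤ φ k := by
    have h1 := hle k⁻¹
    have h2 := hφinv k
    nlinarith [hφpos k, hφpos k⁻¹]
  exact le_antisymm (hle k) hge

variable [MeasurableSpace 𝔸] [BorelSpace 𝔸] [MeasurableSpace K] [BorelSpace K]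

omit [NormedAlgebra ℚ 𝔸] [CompleteSpace 𝔸] [IsTopologicalGroup K] [MeasurableSpace K] [BorelSpace K] in
/-- Left multiplication by `ρ(k)` preserves every additive Haar measure of `𝔸`. [folklore] -/
theorem map_mulLeft_addHaar (ρ : K →* 𝔸) (hρc : Continuous ρ) (μ : Measure 𝔸)
    [μ.IsAddHaarMeasure] (k : K) : Measure.map (fun M => ρ k * M) μ = μ := by
  have hdet : LinearMap.det ((ContinuousLinearMap.mul ℝ 𝔸 (ρ k) : 𝔸 →L[ℝ] 𝔸) : 𝔸 →ₗ[ℝ] 𝔸) ≠ 0 := by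
    have h := abs_det_mulLeft_eq_one ρ hρc k
    rw [ContinuousLinearMap.det] at h
    intro h0; rw [h0, abs_zero] at h; exact zero_ne_one h
  have key := Measure.map_linearMap_addHaar_eq_smul_addHaar (μ := μ) hdet
  have habs : |(LinearMap.det ((ContinuousLinearMap.mul ℝ 𝔸 (ρ k) : 𝔸 →L[ℝ] 𝔸) :
      𝔸 →ₗ[ℝ] 𝔸))⁻¹| = 1 := by
    rw [abs_inv, ← ContinuousLinearMap.det, abs_det_mulLeft_eq_one ρ hρc k, inv_one]
  rw [habs, ENNReal.ofReal_one, one_smul] at key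
  have hfun : (fun M => ρ k * M) =
      ⇑(((ContinuousLinearMap.mul ℝ 𝔸 (ρ k) : 𝔸 →L[ℝ] 𝔸) : 𝔸 →ₗ[ℝ] 𝔸)) := by
    funext M; simp
  rw [hfun]; exact key

/-- **Haar measure of a compact linear group as a push-forward of Lebesgue measure on a tube.**
For a continuous injective multiplicative `ρ : K →* 𝔸` from a compact group into a
finite-dimensional real Banach algebra with additive Haar measure `μ`: there are an open `T`, a
compact `Ω ⊆ T` with `1 ∈ interior Ω` and `Ω = {M ∈ T : 0 ≤ g M}`, maps `q` (group part) and `g`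
real-analytic on `T` with `q 1 = 1`, a lift `qK : 𝔸 → K` with `ρ (qK M) = q M` on `T`, and a
constant `0 < c < ∞` with `c ∫ F dHaar_K = ∫_Ω F (qK M) dμ(M)` for all measurable `F : K → [0,∞]`
(`haarMeasure ⊤` the Haar probability measure). [folklore] -/
theorem exists_haar_lintegral_eq_tube (ρ : K →* 𝔸) (hρc : Continuous ρ) (hρi : Injective ρ)
    (μ : Measure 𝔸) [μ.IsAddHaarMeasure] :
    ∃ (T Ω : Set 𝔸) (q : 𝔸 → 𝔸) (g : 𝔸 → ℝ) (qK : 𝔸 → K) (c : ℝ≥0∞),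
      IsOpen T ∧ Ω ⊆ T ∧ IsCompact Ω ∧ (1 : 𝔸) ∈ interior Ω ∧ Ω = {M ∈ T | 0 ≤ g M} ∧
      AnalyticOnNhd ℝ q T ∧ AnalyticOnNhd ℝ g T ∧ q 1 = 1 ∧ (∀ M ∈ T, ρ (qK M) = q M) ∧
      c ≠ 0 ∧ c ≠ ∞ ∧
      ∀ F : K → ℝ≥0∞, Measurable F →
        c * ∫⁻ k, F k ∂haarMeasure ⊤ = ∫⁻ M in Ω, F (qK M) ∂μ := by
  obtain ⟨T, Ω, q, g, qK, hTopen, hΩT, hΩcpt, h1int, hΩeq, hqan, hgan, hqKcont, hq1, hqK,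
    hTinv, hΩinv⟩ := exists_invariantTube ρ hρc hρi
  have hΩmeas : MeasurableSet Ω := hΩcpt.isClosed.measurableSet
  have hqKae : AEMeasurable qK (μ.restrict Ω) := (hqKcont.mono hΩT).aemeasurable hΩmeas
  haveI : IsFiniteMeasure (μ.restrict Ω) :=
    ⟨by rw [Measure.restrict_apply_univ]; exact hΩcpt.measure_lt_top⟩
  set ν : Measure K := Measure.map qK (μ.restrict Ω) with hν
  haveI : IsFiniteMeasure ν := Measure.isFiniteMeasure_map _ _
  -- left invariance of `ν`
  have hmapL : ∀ k : K, Measure.map (fun M => ρ k * M) (μ.restrict Ω) = μ.restrict Ω := by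
    intro k
    have hLmeas : Measurable fun M : 𝔸 => ρ k * M := measurable_const_mul (ρ k)
    have h := Measure.restrict_map (μ := μ) hLmeas hΩmeas
    rw [map_mulLeft_addHaar ρ hρc μ k, hΩinv k] at h
    exact h.symm
  haveI : IsMulLeftInvariant ν := by
    refine ⟨fun k => ?_⟩
    have hkm : Measurable fun x : K => k * x := measurable_const_mul k
    calc Measure.map (fun x => k * x) ν
        = Measure.map ((fun x => k * x) ∘ qK) (μ.restrict Ω) :=
          AEMeasurable.map_map_of_aemeasurable hkm.aemeasurable hqKae
      _ = Measure.map (qK ∘ fun M => ρ k * M) (μ.restrict Ω) := by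
          refine Measure.map_congr (ae_restrict_of_forall_mem hΩmeas fun M hM => ?_)
          simp only [Function.comp_apply]
          exact ((hTinv k M (hΩT hM)).2).symm
      _ = Measure.map qK (Measure.map (fun M => ρ k * M) (μ.restrict Ω)) := by
          refine (AEMeasurable.map_map_of_aemeasurable ?_
            (measurable_const_mul (ρ k)).aemeasurable).symm
          rw [hmapL k]; exact hqKae
      _ = ν := by rw [hmapL k]
  -- uniqueness of Haar measure on the compact group `K`
  have hνeq : ν = haarScalarFactor ν (haarMeasure ⊤) • haarMeasure ⊤ :=
    Measure.isMulInvariant_eq_smul_of_compactSpace ν (haarMeasure ⊤)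
  set c : ℝ≥0 := haarScalarFactor ν (haarMeasure ⊤) with hc
  -- `ν ≠ 0`
  have hνuniv : ν univ = μ Ω := by
    rw [hν, Measure.map_apply_of_aemeasurable hqKae MeasurableSet.univ, preimage_univ,
      Measure.restrict_apply_univ]
  have hΩpos : 0 < μ Ω :=
    (isOpen_interior.measure_pos μ ⟨1, h1int⟩).trans_le (measure_mono interior_subset)
  have hc0 : (c : ℝ≥0∞) ≠ 0 := by
    intro h0
    have : ν = 0 := by
      rw [hνeq]
      have : c = 0 := by exact_mod_cast h0
      rw [this, zero_smul]
    rw [this, Measure.coe_zero, Pi.zero_apply] at hνuniv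
    exact hΩpos.ne' hνuniv.symm
  refine ⟨T, Ω, q, g, qK, c, hTopen, hΩT, hΩcpt, h1int, hΩeq, hqan, hgan, hq1, hqK, hc0,
    ENNReal.coe_ne_top, fun F hF => ?_⟩
  calc (c : ℝ≥0∞) * ∫⁻ k, F k ∂haarMeasure ⊤ = ∫⁻ k, F k ∂((c : ℝ≥0∞) • haarMeasure ⊤) := by
        rw [lintegral_smul_measure, smul_eq_mul]
    _ = ∫⁻ k, F k ∂ν := by rw [hνeq, ENNReal.smul_def]
    _ = ∫⁻ M in Ω, F (qK M) ∂μ := lintegral_map' (hF.aemeasurable) hqKae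

end Literature.MeasureTheory.Group

end
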